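import Summits.QuantumFields.BalabanUV.T4Continuum.Support.B13TermHistSecant
import Summits.QuantumFields.BalabanUV.T4Continuum.Support.B13StepOfRecord

/-!
# NE5 ∕ U3, route P2 — the OPERATOR half of W2 AT ACTIVITY LEVEL: `OpLipschitz` for any step model whose output is the B13 series,
# PRODUCED from a TERMWISE relative operator modulus of the (2.14)-activity terms (the operator twin of leaf-03's
# `B13TermHistSecant.histSecant_b13_of_act`; route P2's mechanism «activity Lipschitz ⟹ output Lipschitz through the convergent
# expansion» in the ORDERED form of (2.13), after R-IDENT)

Cell `pub-balaban`, unit `b2b-balaban-t4-ne5-p2` (T⁴ fan-out NE5 ∕ node U3, PROVER seat P2 «polymer-activity Lipschitz ∕ Kotecký–Preiss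
route», lineage gen 18).  Summits-side new work under the LEAN PLACEMENT RULE (cell bookkeeping over the swarm's typed objects; NOT a
Literature module; nothing of the manuscripts under audit is asserted — [Balaban1988RG2Cluster] (2.13)–(2.17) pp. 14–16 are cited for
FORM only).  HONEST FRAMING: rung (B)+1 of the FINITE-VOLUME T⁴ continuum programme — NOT infinite volume, NOT a mass gap, NOT the
Clay problem, and NOT a proof of NE5 (spine 0∕9): the output-level wall W2-op (`T4InputCauchyRateSpecies.OpLipschitz`, cell GAPS
G-ne5p1-1′, NOT PRINTED) is NOT proved here — it is RELOCATED to the activity level: `OpLipschitz` ⟸ a termwise relative operator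
modulus `ActOpLip` (displayed, NOT PRINTED as a class statement; printed KIND: the operator-replacement estimates (2.16)–(2.17) p. 16
of [II]; for Gaussian-tilt terms it is the CONCLUSION of route P2's tilt lemma `ActivityTermDatum.norm_term_sub_le`) × the swarm's
convergence binder and a per-domain first-moment budget.  HONEST DEPENDENCY (cell line, verbatim): continuum YM on T⁴ ⇐ BetaPertH ∧
nine spine estimates (0/9 proved); BetaPertH ⇐ (D1) ∧ (D4) ∧ CAP+tail; G-an2-4 gates asym, D1 and NE2/3/4.

WHAT.
* §1 `norm_prod_sub_prod_le` — the TELESCOPING of a product difference: factors bounded by `A m` and differing by `≤ N m·A m` give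
  `‖Π a − Π b‖ ≤ (Σ_m N m)·Π_m A m` (induction on the tuple length; no analyticity, no reach).
* §2 for a term indexing `𝒯`, hard core `inc`, activity terms `act` (leaf-08's `B13StepTermFamily`): the TERMWISE two-point bound
  `norm_term_sub_term_le_of_factors` — `‖term k i q X − term k i q′ X‖ ≤ secMajorant N A k X i · r` whenever every factor is bounded
  by `A` at both inputs and moves by `≤ N·r·A` (`secMajorant` = leaf-03's `(Σ_m N)·actMajorant A`, REUSED BY NAME — one currency for
  both halves of W2); hence the GENERAL TWO-INPUT SECANT OF THE OUTPUT `norm_out_sub_out_le` (`‖out k q X − out k q′ X‖ ≤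
  (Σ'ᵢ secMajorant)·r` under d3's convergence binder at both inputs and summability of the secant majorant) — route P2's
  «two-run activity discrepancy ⟹ output discrepancy» ((M2)–(M3) of `t4/skeletons/NE5-t4-ne5-p2.md`) in the model of record's
  ordered form, with NO Kotecký–Preiss inflation room and NO analyticity.
* §3 the hypothesis SHAPES `ActOpBound` (termwise absolute majorant near base points — the `hA` binder of
  `B13TermRep.termRep_b13_of_actBound` read on the operator ball) and `ActOpLip` (termwise RELATIVE operator modulus `N`), and
  **`opLipschitz_b13_of_actOpLip`**: for ANY `M` with `M.Out = out 𝒯 inc act`, `ActOpBound` ∧ `ActOpLip` ∧ d3's convergence binder ∧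
  the per-domain budget `Σ'ᵢ secMajorant (N k g U) (A k g U) k X i ≤ G₁·e^{−κd(X)}` ⟹ **`OpLipschitz M W κ G₁ ρ₀`** — literally the
  `hopL` binder of the swarm's secant END faces (`B13StepSecantEnd.ne5_of_assembly_secant`, `B13StepOfRecordSecantEnd`); instantiated
  for the assembled model `Assembly.step` (`opLipschitz_step_of_actOpLip`) and for the MODEL OF RECORD `B13StepOfRecord.step S E₀ cB`
  (`opLipschitz_record_of_actOpLip`).
No estimate about Bałaban's kernels is proved or assumed beyond the displayed termwise binders.  `FlowStep.BetaPertH`, (B), (B^μ) do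
not occur.  0 sorry; axioms ⊆ {propext, Classical.choice, Quot.sound}.
-/

noncomputable section

open scoped BigOperators

namespace Summit.QuantumFields.BalabanUV.T4Continuum.B13TermOpSecant

open Literature.MathematicalPhysics.QuantumFieldTheory.Balaban1983to89.T4OutputRate (Carriers)
open Literature.MathematicalPhysics.QuantumFieldTheory.Balaban1983to89.T4InputCauchyRateData (StepModel)
open Literature.MathematicalPhysics.QuantumFieldTheory.Balaban1983to89.T4InputCauchyRateSpecies (OpLipschitz)
open Summit.QuantumFields.BalabanUV.T4Continuum.B13StepTermFamily (TermIndexing term out coeff term_of_rel term_of_not_rel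
  hasSum_term_out)
open Summit.QuantumFields.BalabanUV.T4Continuum.B13TermRep (actMajorant actMajorant_of_rel summable_term_of_actBound)
open Summit.QuantumFields.BalabanUV.T4Continuum.B13TermHistSecant (secMajorant secMajorant_of_not_rel)
open Summit.QuantumFields.BalabanUV.T4Continuum.B13OpDatum (OpDatum)
open Summit.QuantumFields.BalabanUV.T4Continuum.B13Represents (Assembly)
open Summit.QuantumFields.BalabanUV.T4Continuum.B13Carriers (TwoRuns)
open Summit.QuantumFields.BalabanUV.T4Continuum.B13StepOfRecord (Slots step)

/-! ## §1 Telescoping a product difference -/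

/-- [folklore] **TELESCOPING**: if every factor of two tuples is bounded in norm by `A m ≥ 0` and the factors differ by at most
`N m·A m` (`N m ≥ 0`), the products differ by at most `(Σ_m N m)·Π_m A m`. -/
theorem norm_prod_sub_prod_le {n : ℕ} (a b : Fin n → ℂ) (A N : Fin n → ℝ) (hA : ∀ m, 0 ≤ A m) (hN : ∀ m, 0 ≤ N m)
    (ha : ∀ m, ‖a m‖ ≤ A m) (hb : ∀ m, ‖b m‖ ≤ A m) (hab : ∀ m, ‖a m - b m‖ ≤ N m * A m) :
    ‖∏ m, a m - ∏ m, b m‖ ≤ (∑ m, N m) * ∏ m, A m := by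
  induction n with
  | zero => simp
  | succ n ih =>
    rw [Fin.prod_univ_succ, Fin.prod_univ_succ, Fin.sum_univ_succ, Fin.prod_univ_succ]
    have hPa : ‖∏ m : Fin n, a m.succ‖ ≤ ∏ m : Fin n, A m.succ := by
      rw [norm_prod]
      exact Finset.prod_le_prod (fun m _ => norm_nonneg _) fun m _ => ha m.succ
    have hIH := ih (fun m => a m.succ) (fun m => b m.succ) (fun m => A m.succ) (fun m => N m.succ) (fun m => hA _)
      (fun m => hN _) (fun m => ha _) (fun m => hb _) (fun m => hab _)
    calc ‖a 0 * ∏ m : Fin n, a m.succ - b 0 * ∏ m : Fin n, b m.succ‖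
        = ‖(a 0 - b 0) * ∏ m : Fin n, a m.succ + b 0 * (∏ m : Fin n, a m.succ - ∏ m : Fin n, b m.succ)‖ := by
          congr 1; ring
      _ ≤ ‖a 0 - b 0‖ * ‖∏ m : Fin n, a m.succ‖ + ‖b 0‖ * ‖∏ m : Fin n, a m.succ - ∏ m : Fin n, b m.succ‖ := by
          refine (norm_add_le _ _).trans ?_
          rw [norm_mul, norm_mul]
      _ ≤ N 0 * A 0 * ∏ m : Fin n, A m.succ + A 0 * ((∑ m : Fin n, N m.succ) * ∏ m : Fin n, A m.succ) :=
          add_le_add (mul_le_mul (hab 0) hPa (norm_nonneg _) (mul_nonneg (hN 0) (hA 0)))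
            (mul_le_mul (hb 0) hIH (norm_nonneg _) (hA 0))
      _ = (N 0 + ∑ m : Fin n, N m.succ) * (A 0 * ∏ m : Fin n, A m.succ) := by ring

/-! ## §2 The termwise two-point bound and the two-input secant of the output -/

section Terms

variable {C : Carriers} {ι P J Op Hist : Type*} (𝒯 : TermIndexing C ι P J) (inc : P → P → Prop) [DecidableRel inc]
  (act : P → J → Op → Hist → ℂ)

/-- [folklore] **THE TERMWISE TWO-POINT BOUND**: if at the inputs `q`, `q′` every factor of the term `i` is bounded by `A` and moves by
at most `N·r·A`, then `‖term k i q X − term k i q′ X‖ ≤ secMajorant N A k X i · r` (telescoping inside `((n+1)!)⁻¹ρᵀ·Π act`; the secant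
majorant is leaf-03's `(Σ_m N)·actMajorant A`, so both halves of W2 are budgeted in ONE currency). -/
theorem norm_term_sub_term_le_of_factors {k : ℕ} {i : ι} {X : C.Dom} (q q' : Op × Hist) {A N : P → J → ℝ} {r : ℝ}
    (hr : 0 ≤ r) (hA0 : ∀ Z j, 0 ≤ A Z j) (hN0 : ∀ Z j, 0 ≤ N Z j)
    (ha : 𝒯.Rel k i X → ∀ m, ‖act (𝒯.poly i m) (𝒯.lab i m) q.1 q.2‖ ≤ A (𝒯.poly i m) (𝒯.lab i m))
    (hb : 𝒯.Rel k i X → ∀ m, ‖act (𝒯.poly i m) (𝒯.lab i m) q'.1 q'.2‖ ≤ A (𝒯.poly i m) (𝒯.lab i m))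
    (hab : 𝒯.Rel k i X → ∀ m, ‖act (𝒯.poly i m) (𝒯.lab i m) q.1 q.2 - act (𝒯.poly i m) (𝒯.lab i m) q'.1 q'.2‖ ≤
      N (𝒯.poly i m) (𝒯.lab i m) * r * A (𝒯.poly i m) (𝒯.lab i m)) :
    ‖term 𝒯 inc act k i q.1 q.2 X - term 𝒯 inc act k i q'.1 q'.2 X‖ ≤ secMajorant 𝒯 inc N A k X i * r := by
  by_cases hR : 𝒯.Rel k i X
  · rw [term_of_rel 𝒯 inc act hR, term_of_rel 𝒯 inc act hR, ← mul_sub, norm_mul, secMajorant, actMajorant_of_rel hR]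
    have htel := norm_prod_sub_prod_le (fun m => act (𝒯.poly i m) (𝒯.lab i m) q.1 q.2)
      (fun m => act (𝒯.poly i m) (𝒯.lab i m) q'.1 q'.2) (fun m => A (𝒯.poly i m) (𝒯.lab i m))
      (fun m => N (𝒯.poly i m) (𝒯.lab i m) * r) (fun m => hA0 _ _) (fun m => mul_nonneg (hN0 _ _) hr) (ha hR) (hb hR)
      (fun m => hab hR m)
    rw [← Finset.sum_mul] at htel
    calc ‖coeff 𝒯 inc i‖ * ‖∏ m, act (𝒯.poly i m) (𝒯.lab i m) q.1 q.2 - ∏ m, act (𝒯.poly i m) (𝒯.lab i m) q'.1 q'.2‖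
        ≤ ‖coeff 𝒯 inc i‖ * ((∑ m, N (𝒯.poly i m) (𝒯.lab i m)) * r * ∏ m, A (𝒯.poly i m) (𝒯.lab i m)) :=
          mul_le_mul_of_nonneg_left htel (norm_nonneg _)
      _ = (∑ m, N (𝒯.poly i m) (𝒯.lab i m)) * (‖coeff 𝒯 inc i‖ * ∏ m, A (𝒯.poly i m) (𝒯.lab i m)) * r := by ring
  · rw [term_of_not_rel 𝒯 inc act hR, term_of_not_rel 𝒯 inc act hR, sub_zero, norm_zero, secMajorant_of_not_rel hR, zero_mul]

/-- [folklore] **THE TWO-INPUT SECANT OF THE OUTPUT** (route P2's «activity discrepancy ⟹ output discrepancy» in the ordered form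
of (2.13), no inflation room, no analyticity): at a step-`k` domain `X`, if at both inputs every factor of every localizing term is
bounded by `A` and moves by `≤ N·r·A`, the term majorant `actMajorant A k X` is summable (d3's convergence binder) and the secant
majorant is summable, then `‖out k q X − out k q′ X‖ ≤ (Σ'ᵢ secMajorant N A k X i)·r`. -/
theorem norm_out_sub_out_le {k : ℕ} {X : C.Dom} (q q' : Op × Hist) {A N : P → J → ℝ} {r : ℝ} (hr : 0 ≤ r)
    (hA0 : ∀ Z j, 0 ≤ A Z j) (hN0 : ∀ Z j, 0 ≤ N Z j)
    (ha : ∀ i, 𝒯.Rel k i X → ∀ m, ‖act (𝒯.poly i m) (𝒯.lab i m) q.1 q.2‖ ≤ A (𝒯.poly i m) (𝒯.lab i m))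
    (hb : ∀ i, 𝒯.Rel k i X → ∀ m, ‖act (𝒯.poly i m) (𝒯.lab i m) q'.1 q'.2‖ ≤ A (𝒯.poly i m) (𝒯.lab i m))
    (hab : ∀ i, 𝒯.Rel k i X → ∀ m, ‖act (𝒯.poly i m) (𝒯.lab i m) q.1 q.2 - act (𝒯.poly i m) (𝒯.lab i m) q'.1 q'.2‖ ≤
      N (𝒯.poly i m) (𝒯.lab i m) * r * A (𝒯.poly i m) (𝒯.lab i m))
    (hconv : Summable (actMajorant 𝒯 inc A k X)) (hsec : Summable (secMajorant 𝒯 inc N A k X)) :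
    ‖out 𝒯 inc act k q.1 q.2 X - out 𝒯 inc act k q'.1 q'.2 X‖ ≤ (∑' i, secMajorant 𝒯 inc N A k X i) * r := by
  have hs : HasSum (fun i => term 𝒯 inc act k i q.1 q.2 X) (out 𝒯 inc act k q.1 q.2 X) :=
    hasSum_term_out 𝒯 inc act (summable_term_of_actBound ha hconv)
  have hs' : HasSum (fun i => term 𝒯 inc act k i q'.1 q'.2 X) (out 𝒯 inc act k q'.1 q'.2 X) :=
    hasSum_term_out 𝒯 inc act (summable_term_of_actBound hb hconv)
  exact (hs.sub hs').norm_le_of_bounded (hsec.hasSum.mul_right _) fun i =>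
    norm_term_sub_term_le_of_factors 𝒯 inc act q q' hr hA0 hN0 (ha i) (hb i) (hab i)

end Terms

/-! ## §3 `OpLipschitz` from a termwise operator modulus -/

section OpHalf

variable {C : Carriers} {ι P J Op Hist : Type*} [NormedAddCommGroup Op] [NormedSpace ℂ Op] [NormedAddCommGroup Hist]
  [NormedSpace ℂ Hist] (𝒯 : TermIndexing C ι P J) (inc : P → P → Prop) [DecidableRel inc] (act : P → J → Op → Hist → ℂ)
  (M : StepModel C Op Hist)

/-- [folklore] HYPOTHESIS SHAPE `ActOpBound` (displayed, asserted nowhere; the `hA` binder of `B13TermRep.termRep_b13_of_actBound` READ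
ON THE OPERATOR BALL): at every base point `p` and every operator datum `o` within relative reach `ρ₀` of `p.1`, at the history `p.2`,
every factor of every term localizing at a step-`k` domain is bounded by the majorant `A k g U` ((2.15)∕(2.38) KIND). -/
def ActOpBound (W : Set (ℕ → ℝ)) (ρ₀ : ℝ) (A : ℕ → (ℕ → ℝ) → C.BgB → P → J → ℝ) : Prop :=
  ∀ k, ∀ g ∈ W, ∀ (U : C.BgB) (p : Op × Hist), p ∈ M.Base k g U → ∀ o : Op, ‖o - p.1‖ ≤ ρ₀ * M.rOp k →
    ∀ X : C.Dom, C.scale X = k → ∀ i, 𝒯.Rel k i X → ∀ m,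
      ‖act (𝒯.poly i m) (𝒯.lab i m) o p.2‖ ≤ A k g U (𝒯.poly i m) (𝒯.lab i m)

/-- [folklore] HYPOTHESIS SHAPE `ActOpLip` (displayed, asserted nowhere; NOT PRINTED as a class statement — printed KIND: the
operator-replacement estimates (2.16)–(2.17) p. 16 of [II]; for route P2's Gaussian-tilt terms it is the conclusion of the tilt lemma
`ActivityTermDatum.norm_term_sub_le`): the TERMWISE RELATIVE OPERATOR MODULUS — moving the operator datum from the base point `p.1`
to `o` within reach moves each factor by at most `N·(‖o − p.1‖∕rOp k)·A`. -/
def ActOpLip (W : Set (ℕ → ℝ)) (ρ₀ : ℝ) (N A : ℕ → (ℕ → ℝ) → C.BgB → P → J → ℝ) : Prop :=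
  ∀ k, ∀ g ∈ W, ∀ (U : C.BgB) (p : Op × Hist), p ∈ M.Base k g U → ∀ o : Op, ‖o - p.1‖ ≤ ρ₀ * M.rOp k →
    ∀ X : C.Dom, C.scale X = k → ∀ i, 𝒯.Rel k i X → ∀ m,
      ‖act (𝒯.poly i m) (𝒯.lab i m) o p.2 - act (𝒯.poly i m) (𝒯.lab i m) p.1 p.2‖ ≤
        N k g U (𝒯.poly i m) (𝒯.lab i m) * (‖o - p.1‖ / M.rOp k) * A k g U (𝒯.poly i m) (𝒯.lab i m)

variable {𝒯 inc act M}

/-- [folklore] **W2-op AT ACTIVITY LEVEL — `OpLipschitz` FROM THE TERMWISE OPERATOR MODULUS.**  For ANY step model whose output is the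
B13 series (`M.Out = out 𝒯 inc act`): `ActOpBound … A`, `ActOpLip … N A` (`N, A ≥ 0`, reach `ρ₀ ≥ 0`), row O1-d3's convergence binder
`Summable (actMajorant (A k g U) k X)` and the per-domain first-moment budget `Summable (secMajorant (N k g U) (A k g U) k X) ∧
Σ'ᵢ secMajorant … ≤ G₁·e^{−κd(X)}` (the SAME budget shape as `histSecant_b13_of_act`) ⟹ **`OpLipschitz M W κ G₁ ρ₀`** — literally the
`hopL` binder of the swarm's secant END faces.  NOT a proof of W2-op: the termwise modulus is displayed. -/
theorem opLipschitz_b13_of_actOpLip (hM : ∀ k o h X, M.Out k o h X = out 𝒯 inc act k o h X) {W : Set (ℕ → ℝ)}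
    {ρ₀ κ G₁ : ℝ} {N A : ℕ → (ℕ → ℝ) → C.BgB → P → J → ℝ} (hρ₀ : 0 ≤ ρ₀) (hA0 : ∀ k g U Z j, 0 ≤ A k g U Z j)
    (hN0 : ∀ k g U Z j, 0 ≤ N k g U Z j) (habs : ActOpBound 𝒯 act M W ρ₀ A) (hlip : ActOpLip 𝒯 act M W ρ₀ N A)
    (hconv : ∀ k, ∀ g ∈ W, ∀ (U : C.BgB) (X : C.Dom), C.scale X = k → Summable (actMajorant 𝒯 inc (A k g U) k X))
    (hmom : ∀ k, ∀ g ∈ W, ∀ (U : C.BgB) (X : C.Dom), C.scale X = k →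
      Summable (secMajorant 𝒯 inc (N k g U) (A k g U) k X) ∧
        ∑' i, secMajorant 𝒯 inc (N k g U) (A k g U) k X i ≤ G₁ * Real.exp (-(κ * C.d X))) :
    OpLipschitz M W κ G₁ ρ₀ := by
  intro k g hg U p hp X hX o ho
  have hp0 : ‖p.1 - p.1‖ ≤ ρ₀ * M.rOp k := by
    rw [sub_self, norm_zero]; exact mul_nonneg hρ₀ (M.rOp_pos k).le
  obtain ⟨hsm, hle⟩ := hmom k g hg U X hX
  have hr : 0 ≤ ‖o - p.1‖ / M.rOp k := div_nonneg (norm_nonneg _) (M.rOp_pos k).le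
  have h1 := norm_out_sub_out_le 𝒯 inc act (k := k) (X := X) (o, p.2) (p.1, p.2) hr (hA0 k g U) (hN0 k g U)
    (fun i hi m => habs k g hg U p hp o ho X hX i hi m) (fun i hi m => habs k g hg U p hp p.1 hp0 X hX i hi m)
    (fun i hi m => hlip k g hg U p hp o ho X hX i hi m) (hconv k g hg U X hX) hsm
  rw [hM, hM]
  calc ‖out 𝒯 inc act k o p.2 X - out 𝒯 inc act k p.1 p.2 X‖
      ≤ (∑' i, secMajorant 𝒯 inc (N k g U) (A k g U) k X i) * (‖o - p.1‖ / M.rOp k) := h1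
    _ ≤ G₁ * Real.exp (-(κ * C.d X)) * (‖o - p.1‖ / M.rOp k) := mul_le_mul_of_nonneg_right hle hr
    _ = G₁ * (‖o - p.1‖ / M.rOp k) * Real.exp (-(κ * C.d X)) := by ring

end OpHalf

/-! ## §4 The two models of the cell: the assembled step and the step OF RECORD -/

section Models

/-- [folklore] **W2-op AT ACTIVITY LEVEL FOR THE ASSEMBLED STEP MODEL** `B13Represents.Assembly.step` (rows O1-b∕c∕d∕f): the termwise
operator data ⟹ `OpLipschitz (𝔄.step BHist) W κ G₁ ρ₀`. -/
theorem opLipschitz_step_of_actOpLip {C : Carriers} {E IOp Hist ι P J : Type*} [NormedAddCommGroup Hist] [NormedSpace ℂ Hist]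
    (𝔄 : Assembly C E IOp Hist ι P J) (BHist : ℕ → ℝ) {W : Set (ℕ → ℝ)} {ρ₀ κ G₁ : ℝ}
    {N A : ℕ → (ℕ → ℝ) → C.BgB → P → J → ℝ} (hρ₀ : 0 ≤ ρ₀) (hA0 : ∀ k g U Z j, 0 ≤ A k g U Z j)
    (hN0 : ∀ k g U Z j, 0 ≤ N k g U Z j) (habs : ActOpBound 𝔄.𝒯 𝔄.act (𝔄.step BHist) W ρ₀ A)
    (hlip : ActOpLip 𝔄.𝒯 𝔄.act (𝔄.step BHist) W ρ₀ N A)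
    (hconv : ∀ k, ∀ g ∈ W, ∀ (U : C.BgB) (X : C.Dom), C.scale X = k → Summable (actMajorant 𝔄.𝒯 𝔄.inc (A k g U) k X))
    (hmom : ∀ k, ∀ g ∈ W, ∀ (U : C.BgB) (X : C.Dom), C.scale X = k →
      Summable (secMajorant 𝔄.𝒯 𝔄.inc (N k g U) (A k g U) k X) ∧
        ∑' i, secMajorant 𝔄.𝒯 𝔄.inc (N k g U) (A k g U) k X i ≤ G₁ * Real.exp (-(κ * C.d X))) :
    OpLipschitz (𝔄.step BHist) W κ G₁ ρ₀ :=
  opLipschitz_b13_of_actOpLip (M := 𝔄.step BHist) (fun _ _ _ _ => rfl) hρ₀ hA0 hN0 habs hlip hconv hmom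

/-- [folklore] **W2-op AT ACTIVITY LEVEL FOR THE STEP MODEL OF RECORD** `B13StepOfRecord.step S E₀ cB` (indexing `labelsIndexing`, hard
core `touchInc` of the geometry of record, slots `S`): the termwise operator data ⟹ `OpLipschitz (step S E₀ cB) W κ G₁ ρ₀` — the
`hopL` binder of `B13StepOfRecordSecantEnd` relocated to the (2.14)-terms `S.act`. -/
theorem opLipschitz_record_of_actOpLip {G : Type}
    [Literature.MathematicalPhysics.QuantumFieldTheory.Balaban1983to89.GaugeGroup G] {R : TwoRuns G} {E IOp Hist : Type*}
    [NormedAddCommGroup Hist] [NormedSpace ℂ Hist] (S : Slots R E IOp Hist) (E₀ cB : ℝ) {W : Set (ℕ → ℝ)} {ρ₀ κ G₁ : ℝ}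
    {N A : ℕ → (ℕ → ℝ) → R.carriers.BgB → R.carriers.Dom →
      B13StepTermLabels.InnerLabel R.carriers.Dom (B13InnerData.Bnd R) → ℝ}
    (hρ₀ : 0 ≤ ρ₀) (hA0 : ∀ k g U Z j, 0 ≤ A k g U Z j) (hN0 : ∀ k g U Z j, 0 ≤ N k g U Z j)
    (habs : ActOpBound (B13StepOfRecord.assembly S).𝒯 S.act (step S E₀ cB) W ρ₀ A)
    (hlip : ActOpLip (B13StepOfRecord.assembly S).𝒯 S.act (step S E₀ cB) W ρ₀ N A)
    (hconv : ∀ k, ∀ g ∈ W, ∀ (U : R.carriers.BgB) (X : R.carriers.Dom), R.carriers.scale X = k →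
      Summable (actMajorant (B13StepOfRecord.assembly S).𝒯 (B13StepOfRecord.assembly S).inc (A k g U) k X))
    (hmom : ∀ k, ∀ g ∈ W, ∀ (U : R.carriers.BgB) (X : R.carriers.Dom), R.carriers.scale X = k →
      Summable (secMajorant (B13StepOfRecord.assembly S).𝒯 (B13StepOfRecord.assembly S).inc (N k g U) (A k g U) k X) ∧
        ∑' i, secMajorant (B13StepOfRecord.assembly S).𝒯 (B13StepOfRecord.assembly S).inc (N k g U) (A k g U) k X i ≤
          G₁ * Real.exp (-(κ * R.carriers.d X))) :
    OpLipschitz (step S E₀ cB) W κ G₁ ρ₀ :=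
  opLipschitz_step_of_actOpLip (B13StepOfRecord.assembly S) _ hρ₀ hA0 hN0 habs hlip hconv hmom

end Models

end Summit.QuantumFields.BalabanUV.T4Continuum.B13TermOpSecant

end
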